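import Literature.MathematicalPhysics.QuantumFieldTheory.Balaban1983to89.B11Presentation190

/-!
# `Balaban1983to89.B11Ineq190Actual` — T. Bałaban, *The variational problem and background fields in renormalization group method for lattice
gauge theories*, Commun. Math. Phys. **102** (1985) 277–309 [Balaban1985Variational], Sect. G pp. 307–308, **(190) FOR THE ACTUAL FRÉCHET
DERIVATIVE `(δ/δB)𝓗(B)` OF THE (179) CHART, END TO END AT SCHEME LEVEL**: the printed passage *«This inequality [(189)], the formula (188)
and Lemma 2.1, and finally Proposition 2 and (181), yield (190)»* assembled for the GENUINE derivative — r08 g1's kernel bookkeeping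
`B11SectG.ineq190_of_189` / `ineq190_strong_of_189` (the (182)–(190) chain over abstract ℝ-linear maps with block-majorant letters) fed with
r08 g9's instantiations `B11Eq183Differentiation.eq182_sectG` / `eq184_sectG` / `bound188_sectG` (the carriers `Eq182`, `Eq184`, `Bound188`
HOLD for `fderiv ℂ (chartH179 …) B`, `fderiv ℂ (solA180 …) B`); what is left as hypothesis is exactly the list of LOCATED LEAVES of print —
(189) (author-omitted, G-B11-G2), the kernel letters of `G̃` ([5] (3.42), p. 306), `H₀` ((129)/(130), [5] (3.133)), `H` ((46), [5] Thm 3.12),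
`𝔇` ((73)), Lemma 2.1 [3] (`RowSum`), (2.54) [3], the smallness `q < 1` of (187), and two norm-compatibility letters between the block sizes
and the Banach norms; the output is the shape `h190Y` consumed by p29 g9's `B11Presentation190.ineq190_and_hmv_supSize_chartH179`,
whose consumers' pair `(h190, hmv)` is thereby produced from located leaves only (`ineq190_and_hmv_supSize_sectG`)

statement-level skeleton of published theorems with citation tags; proofs where landed; nothing here is a claim about the Yang–Mills mass gap

PDF held: `paper:balaban1985-cmp102-variational-background` (journal page = PDF page + 276); pp. 306–308 [PDF 30–32] read from the text layer
`p0030.txt`–`p0032.txt` (this seat) and the renders `…-p030-x2.png`–`…-p032-x2.png` (gens 1, 9).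

CITATION HEADER / WHAT IS REPRODUCED.  Mega-formalization `lit-balaban`, HOME `run/shared/lean/pub/lit-balaban/`, reader/typer/fold-owner seat
r08 gen 10 (unit `lit-balaban-r08`).  SKELETON rows **B11.Eq190** (decl of record `B11SectG.Ineq190`, `ineq190_of_189`, `ineq190_strong_of_189`;
head proved-existing «from (189), (188)-boundedness, Lemma 2.1 shapes and the G̃/H₀/H majorants (hypotheses of printed shape)»), **B11.Eq182**
(`B11Eq183Differentiation`, proved p299972), **B11.Prop9** (clause «its functional derivative (182) satisfies the inequalities (190)»).
THE PRINT (p. 308 [32], verbatim): *"Thus Eq. (184) can be solved by the Neumann series expansion 𝔄₀ = (I + G̃((δ²/δA′²)V)(𝒜₀ + H₀B))⁻¹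
(G̃Δ⁽²⁾H₀ − G̃((δ²/δA′²)V)(𝒜₀ + H₀B)H₀) (188) … We do not perform these calculations here … let us formulate a final result only. We have
|Δ(y)(δ²/δA′²)V(A′)𝔄| ≤ O(1)ε₃(L^jη)^{−3} exp(−¼δ₀d(y,y′)) max{|𝔄|_{(−1)}, |∇𝔄|_{(−2)}}, (189) for supp 𝔄 ⊂ Δ̃(y′), A′ satisfying (77),
y ∈ Λ_j. This inequality, the formula (188) and Lemma 2.1, and finally Proposition 2 and (181), yield |(δ/δB_ν(y′))𝓗_μ(B,x)|,
|∇_x(δ/δB_ν(y′))𝓗_μ(B,x)|, ‖ζ∇(δ/δB(y′))𝓗(B)‖_β, |D^{η*}_{U_k}D^η_{U_k}(δ/δB_ν(y))𝓗_μ(B,x)|, |Δ^η_{U_k}(δ/δB_ν(y′))𝓗_μ(B,x)| ≤ O(1)[(L^jη)^{−1},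
(L^jη)^{−2}, (‖ζ‖^#_β + |ζ|)(L^jη)^{−2−β}, (L^jη)^{−3}, (L^jη)^{−3}]·(L^{j′}η)^{−d} exp(−⅛δ₀d(y,y′)) (190) for x ∈ Δ(y), or supp ζ ⊂ Δ̃(y),
y ∈ Λ_j, y′ ∈ Λ_{j′}."*; Proposition 9 (p. 309 [33]): *"… and its functional derivative (182) satisfies the inequalities (190)."*

WHAT THIS FILE PROVES (theorems only; kernel-checked, 0 sorry, standard axioms).  Scheme of `B11Eq183Differentiation` §5 (complex Banach
`𝒳 ∋ B`, `𝒴` = the space of (115), `𝒵`; data `𝒢` (= G̃), `W` (= (δ/δA′)V, analytic on `‖Y‖ < a₃`), `D2` (= Δ⁽²⁾), `H₀`, `H`, the Sect. C map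
`D` with derivative `𝔇` at the point, `Regime` (117)–(121); block sizes `bB` on `𝒳`, `bN`/`bN₂` on `𝒴`, `b3` on `𝒵` over a `B6.Geometry`).
* §1 **`ineq190_sectG`** — (190), entries n = 0, 1, FOR THE ACTUAL DERIVATIVE at a point `B` of the domain of (180):
  `Ineq190 bB bN ((fderiv ℂ (chartH179 𝒢 W D2 H₀ (· − H(D ·)) ε₄) B).restrictScalars ℝ) (const190 …) δ₀` from the located letters (listed
  above; (189) read at the point `A′ = 𝒜₀(B) + H₀B`, the only instance (184) uses); `M0_sectG_nonneg` (the (188) constant is ≥ 0).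
* §2 **`ineq190_strong_sectG`** — entries n = 2, 3, 4 (majorants INTO a second local size `bN₂`: G̃, H₀, H into `bN₂` — (130) p. 298,
  (137)–(139) pp. 298–299): `∃ C ≥ 0, Ineq190 bB bN₂ (…actual derivative…) C δ₀`.
* §3 **`ineq190_sectG_dom`** — the UNIFORM form on the domain `{‖H₀B′‖ < a ∧ ‖Δ⁽²⁾H₀B′‖ < j}` (letters (189)/(73) assumed at every point of
  the domain with uniform constants, as printed «for A′ satisfying (77)»): exactly the hypothesis `h190Y` of
  `B11Presentation190.ineq190_presentation_chartH179` / `ineq190_and_hmv_supSize_chartH179` (p29 g9); and the END-TO-END corollary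
  **`ineq190_and_hmv_supSize_sectG`**: the B14/B15 consumers' PAIR `(∀ t, Ineq190 bB (supSize g box blk) (dH t) C δ₀) ∧ hmv` for any lattice
  presentation of the (179) chart, with `h190Y` DISCHARGED — hypotheses = located leaves + presentation/compatibility letters only.

HONEST SCOPE.  Assembly of landed theorems (this lineage's `B11SectG` gen 1, `B11Eq183Differentiation` gen 9; p29 g9's `B11Presentation190`
for §3's corollary, imported by name, nothing there modified).  NOT discharged (located leaves, each a hypothesis of the printed shape):
(189) `h189` (G-B11-G2 — *«We do not perform these calculations here»*), the kernel letters `hG`/`hG₂` (G̃ «exactly the same properties as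
Δ_a⁻¹», [5] (3.42)–(3.47)), `hH0`/`hH0₂` ((129)–(130), [5] (3.133)), `hH`/`hH₂` ((46), [5] Thm 3.12 kernel form), `hDfr` ((73); for the concrete
C_j of [4] the norm-level (73) is `B11Prop3Concrete.norm_fderiv_Dt_le_73`, the decay form `B11Eq73KernelDecay.ineq73`), `hrow` (Lemma 2.1 [3]),
`htri`/`hd` ((2.54) [3]), `hq` ((187) smallness), `hN`/`hBloc` (size ↔ norm compatibility).  The words *«and finally Proposition 2 and (181)»*
(transport from the base point to a general B, G-B11-G2a) are not typed, as in `B11SectG`.  No lattice object of [4]–[6]; NE9 socket C19′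
frozen; not summit progress.  Imports `B11Presentation190` (→ `B11Eq183Differentiation`, `B11SectG`, `B11MeanValue190`); modifies nothing;
no new named fact (net debt delta 0).
-/

noncomputable section

namespace Literature.MathematicalPhysics.QuantumFieldTheory.Balaban1983to89.B11Ineq190Actual

open Literature.MathematicalPhysics.QuantumFieldTheory.Balaban1983to89
open B11SectG B11Eq174Chart B11Eq183Differentiation B11Presentation190 B11SupSize190 B6RandomWalk Set Metric

section Actual

variable {𝒳 𝒴 𝒵 : Type} [NormedAddCommGroup 𝒳] [NormedSpace ℂ 𝒳] [NormedAddCommGroup 𝒴] [NormedSpace ℂ 𝒴]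
  [NormedAddCommGroup 𝒵] [NormedSpace ℂ 𝒵] [CompleteSpace 𝒳] [CompleteSpace 𝒴] [CompleteSpace 𝒵]
  {𝒢 : 𝒵 →L[ℂ] 𝒴} {W : 𝒴 → 𝒵} {D2 : 𝒴 →L[ℂ] 𝒵} {H₀ : 𝒳 →L[ℂ] 𝒴} {B₀ θ C₄ a₃ j a ε₄ : ℝ}
  {g : B6.Geometry}

/-! ## §1 (190), entries n = 0, 1, for the actual derivative at a point of the domain of (180) -/

omit [CompleteSpace 𝒳] [CompleteSpace 𝒵] in
/-- The (188) constant `M₀ = (1 − ‖G̃((δ²/δA′²)V)(𝒜₀ + H₀B)‖)⁻¹·‖G̃Δ⁽²⁾H₀ − G̃((δ²/δA′²)V)(𝒜₀ + H₀B)H₀‖` of `bound188_sectG` is `≥ 0`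
(the operator in the Neumann series has norm `< 1`, `B11Eq183Differentiation.norm_comp_fderiv_lt_one`). [cite: Balaban1985Variational, (187)–(188) p.308] -/
theorem M0_sectG_nonneg (R : Regime 𝒢 0 W B₀ θ C₄ a₃ j a ε₄) (hWa : AnalyticOnNhd ℂ W {Y : 𝒴 | ‖Y‖ < a₃})
    {B : 𝒳} (hJ : ‖D2 (H₀ B)‖ < j) (h𝔄 : ‖H₀ B‖ < a) :
    0 ≤ (1 - ‖𝒢 ∘L fderiv ℂ W (solA180 𝒢 W D2 H₀ ε₄ B + H₀ B)‖)⁻¹ *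
        ‖𝒢 ∘L (D2 ∘L H₀) - (𝒢 ∘L fderiv ℂ W (solA180 𝒢 W D2 H₀ ε₄ B + H₀ B)) ∘L H₀‖ :=
  mul_nonneg (inv_nonneg.mpr (sub_nonneg.mpr (norm_comp_fderiv_lt_one R hWa hJ.le h𝔄).le)) (norm_nonneg _)

/-- **(190), entries n = 0, 1, FOR THE ACTUAL FRÉCHET DERIVATIVE `(δ/δB)𝓗(B)` of the (179) chart** `𝓗 = Tm(𝒜₀ + H₀B)`, `Tm = A′ ↦ A′ − HD(A′)`
((47)), at a point `B` with `‖H₀B‖ < a`, `‖Δ⁽²⁾H₀B‖ < j`: *«This inequality [(189)], the formula (188) and Lemma 2.1 … yield (190)»* —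
`δ𝓗` has the block majorant `const190·e^{−⅛δ₀d(y,y′)}` from the B-size `bB` into the N-size `bN`.  Proof: `B11SectG.ineq190_of_189` (the
(182)–(190) majorant chain, every O(1) explicit) at the ACTUAL derivatives, its carriers `Eq182`/`Eq184`/`Bound188` being theorems
(`eq182_sectG`, `eq184_sectG`, `bound188_sectG`).  Hypotheses = the located leaves: (189) at `A′ = 𝒜₀(B) + H₀B` (`h189`), the kernel letters
of G̃ (`hG`), H₀ (`hH0`), H (`hH`), 𝔇 = (δ/δA′)D at the point (`hDfr`, (73)), Δ⁽²⁾H₀ (`hD2H0`, (130)), Lemma 2.1 [3] (`hrow`), (2.54) (`htri`,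
`hd`), the smallness `q < 1` of (187) (`hq`), and the size/norm compatibility letters `hN`, `hBloc`.
[cite: Balaban1985Variational, (182)–(190) pp.307–308, Prop. 9 p.309] [cite: Balaban1984PropagatorsII, Lemma 2.1 p.234] -/
theorem ineq190_sectG (R : Regime 𝒢 0 W B₀ θ C₄ a₃ j a ε₄) (hWa : AnalyticOnNhd ℂ W {Y : 𝒴 | ‖Y‖ < a₃})
    {B : 𝒳} (hJ : ‖D2 (H₀ B)‖ < j) (h𝔄 : ‖H₀ B‖ < a) {D : 𝒴 → 𝒳} {𝔇 : 𝒴 →L[ℂ] 𝒳} (H : 𝒳 →L[ℂ] 𝒴)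
    (hD : HasFDerivAt D 𝔇 (solA180 𝒢 W D2 H₀ ε₄ B + H₀ B))
    {bB : BlockNorm g 𝒳} {bN : BlockNorm g 𝒴} {b3 : BlockNorm g 𝒵}
    (hN : ∀ (y : g.Site) (v : 𝒴), bN.loc y v ≤ ‖v‖) (hBloc : ∀ (y' : g.Site) (μ : 𝒳), bB.IsLoc y' μ → ‖μ‖ ≤ bB.loc y' μ)
    {δ₀ BG θW cΔ A₀ AH θD c : ℝ}
    (htri : Triangle254 g) (hd : ∀ a b : g.Site, 0 ≤ g.dist a b) (hδ₀ : 0 ≤ δ₀) (hrow : RowSum g (δ₀ / 8) c)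
    (hc : 0 ≤ c) (hBG : 0 ≤ BG) (hθW : 0 ≤ θW) (hcΔ : 0 ≤ cΔ) (hA₀ : 0 ≤ A₀) (hAH : 0 ≤ AH) (hθD : 0 ≤ θD)
    (hG : HasMaj b3 bN (𝒢.restrictScalars ℝ : 𝒵 →ₗ[ℝ] 𝒴) (fun y y' => BG * Real.exp (-(δ₀ * g.dist y y'))))
    (h189 : Ineq189 bN b3 ((fderiv ℂ W (solA180 𝒢 W D2 H₀ ε₄ B + H₀ B)).restrictScalars ℝ : 𝒴 →ₗ[ℝ] 𝒵) θW δ₀)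
    (hD2H0 : HasMaj bB b3 ((D2 ∘L H₀).restrictScalars ℝ : 𝒳 →ₗ[ℝ] 𝒵) (fun y y' => cΔ * Real.exp (-(δ₀ * g.dist y y'))))
    (hH0 : HasMaj bB bN (H₀.restrictScalars ℝ : 𝒳 →ₗ[ℝ] 𝒴) (fun y y' => A₀ * Real.exp (-(δ₀ * g.dist y y'))))
    (hH : HasMaj bB bN (H.restrictScalars ℝ : 𝒳 →ₗ[ℝ] 𝒴) (fun y y' => AH * Real.exp (-(δ₀ / 2 * g.dist y y'))))
    (hDfr : HasMaj bN bB (𝔇.restrictScalars ℝ : 𝒴 →ₗ[ℝ] 𝒳) (fun y y' => θD * Real.exp (-(δ₀ / 2 * g.dist y y'))))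
    (hq : qG b3.κ bN.κ BG θW c < 1) :
    Ineq190 bB bN
      ((fderiv ℂ (chartH179 𝒢 W D2 H₀ (fun Y : 𝒴 => Y - H (D Y)) ε₄) B).restrictScalars ℝ : 𝒳 →ₗ[ℝ] 𝒴)
      (const190 bB.κ bN.κ b3.κ BG θW cΔ A₀ AH θD c) δ₀ :=
  ineq190_of_189 htri hd hδ₀ hrow hc hBG hθW hcΔ hA₀ hAH hθD (M0_sectG_nonneg R hWa hJ h𝔄) hG h189 hD2H0 hH0 hH hDfr
    (eq184_sectG R hWa hJ h𝔄) (bound188_sectG R hWa hJ h𝔄 hN hBloc) (eq182_sectG R hWa hJ h𝔄 H hD) hq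

/-! ## §2 (190), entries n = 2, 3, 4 (majorants into a second local size) -/

/-- **(190), entries n = 2, 3, 4, for the actual derivative**: with the additional located majorants INTO a second local size `bN₂` on `𝒴`
— G̃ (`hG₂`; p. 306 «exactly the same properties as Δ_a⁻¹», [5] (3.42)–(3.47)), H₀ (`hH0₂`; (130) p. 298), H (`hH₂`; (137)–(139) pp. 298–299) —
`δ𝓗` has a majorant `C·e^{−⅛δ₀d}` into `bN₂` (`B11SectG.ineq190_strong_of_189` at the actual derivatives).
[cite: Balaban1985Variational, (130) p.298, (137)–(139) pp.298–299, (190) p.308] -/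
theorem ineq190_strong_sectG (R : Regime 𝒢 0 W B₀ θ C₄ a₃ j a ε₄) (hWa : AnalyticOnNhd ℂ W {Y : 𝒴 | ‖Y‖ < a₃})
    {B : 𝒳} (hJ : ‖D2 (H₀ B)‖ < j) (h𝔄 : ‖H₀ B‖ < a) {D : 𝒴 → 𝒳} {𝔇 : 𝒴 →L[ℂ] 𝒳} (H : 𝒳 →L[ℂ] 𝒴)
    (hD : HasFDerivAt D 𝔇 (solA180 𝒢 W D2 H₀ ε₄ B + H₀ B))
    {bB : BlockNorm g 𝒳} {bN bN₂ : BlockNorm g 𝒴} {b3 : BlockNorm g 𝒵}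
    (hN : ∀ (y : g.Site) (v : 𝒴), bN.loc y v ≤ ‖v‖) (hBloc : ∀ (y' : g.Site) (μ : 𝒳), bB.IsLoc y' μ → ‖μ‖ ≤ bB.loc y' μ)
    {δ₀ BG BG₂ θW cΔ A₀ A₀₂ AH₂ θD c : ℝ}
    (htri : Triangle254 g) (hd : ∀ a b : g.Site, 0 ≤ g.dist a b) (hδ₀ : 0 ≤ δ₀) (hrow : RowSum g (δ₀ / 8) c)
    (hc : 0 ≤ c) (hBG : 0 ≤ BG) (hBG₂ : 0 ≤ BG₂) (hθW : 0 ≤ θW) (hcΔ : 0 ≤ cΔ) (hA₀ : 0 ≤ A₀) (hA₀₂ : 0 ≤ A₀₂)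
    (hAH₂ : 0 ≤ AH₂) (hθD : 0 ≤ θD)
    (hG : HasMaj b3 bN (𝒢.restrictScalars ℝ : 𝒵 →ₗ[ℝ] 𝒴) (fun y y' => BG * Real.exp (-(δ₀ * g.dist y y'))))
    (hG₂ : HasMaj b3 bN₂ (𝒢.restrictScalars ℝ : 𝒵 →ₗ[ℝ] 𝒴) (fun y y' => BG₂ * Real.exp (-(δ₀ * g.dist y y'))))
    (h189 : Ineq189 bN b3 ((fderiv ℂ W (solA180 𝒢 W D2 H₀ ε₄ B + H₀ B)).restrictScalars ℝ : 𝒴 →ₗ[ℝ] 𝒵) θW δ₀)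
    (hD2H0 : HasMaj bB b3 ((D2 ∘L H₀).restrictScalars ℝ : 𝒳 →ₗ[ℝ] 𝒵) (fun y y' => cΔ * Real.exp (-(δ₀ * g.dist y y'))))
    (hH0 : HasMaj bB bN (H₀.restrictScalars ℝ : 𝒳 →ₗ[ℝ] 𝒴) (fun y y' => A₀ * Real.exp (-(δ₀ * g.dist y y'))))
    (hH0₂ : HasMaj bB bN₂ (H₀.restrictScalars ℝ : 𝒳 →ₗ[ℝ] 𝒴) (fun y y' => A₀₂ * Real.exp (-(δ₀ * g.dist y y'))))
    (hH₂ : HasMaj bB bN₂ (H.restrictScalars ℝ : 𝒳 →ₗ[ℝ] 𝒴) (fun y y' => AH₂ * Real.exp (-(δ₀ / 2 * g.dist y y'))))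
    (hDfr : HasMaj bN bB (𝔇.restrictScalars ℝ : 𝒴 →ₗ[ℝ] 𝒳) (fun y y' => θD * Real.exp (-(δ₀ / 2 * g.dist y y'))))
    (hq : qG b3.κ bN.κ BG θW c < 1) :
    ∃ C : ℝ, 0 ≤ C ∧ Ineq190 bB bN₂
      ((fderiv ℂ (chartH179 𝒢 W D2 H₀ (fun Y : 𝒴 => Y - H (D Y)) ε₄) B).restrictScalars ℝ : 𝒳 →ₗ[ℝ] 𝒴) C δ₀ :=
  ineq190_strong_of_189 htri hd hδ₀ hrow hc hBG hBG₂ hθW hcΔ hA₀ hA₀₂ hAH₂ hθD (M0_sectG_nonneg R hWa hJ h𝔄) hG hG₂ h189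
    hD2H0 hH0 hH0₂ hH₂ hDfr (eq184_sectG R hWa hJ h𝔄) (bound188_sectG R hWa hJ h𝔄 hN hBloc) (eq182_sectG R hWa hJ h𝔄 H hD) hq

/-! ## §3 The uniform form on the domain of (180) (the consumers' `h190Y`) and the end-to-end pair -/

/-- **(190) on the whole domain of (180), uniform constant** — exactly the hypothesis `h190Y` of p29 g9's
`B11Presentation190.ineq190_presentation_chartH179` / `ineq190_and_hmv_supSize_chartH179`: if the Sect. C map `D` is differentiable at the points
`𝒜₀(B′) + H₀B′`, `B′` in the domain, with (73)-majorant `θ_𝔇e^{−½δ₀d}` of its derivative there, and (189) holds at those points with a uniform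
`θ_W` (print: «for A′ satisfying (77)»), the other letters being point-independent, then for EVERY `B′` of the domain `δ𝓗(B′)` has the majorant
`const190·e^{−⅛δ₀d}`. [cite: Balaban1985Variational, (189)–(190) p.308, (77) p.290] -/
theorem ineq190_sectG_dom (R : Regime 𝒢 0 W B₀ θ C₄ a₃ j a ε₄) (hWa : AnalyticOnNhd ℂ W {Y : 𝒴 | ‖Y‖ < a₃})
    {D : 𝒴 → 𝒳} (H : 𝒳 →L[ℂ] 𝒴)
    {bB : BlockNorm g 𝒳} {bN : BlockNorm g 𝒴} {b3 : BlockNorm g 𝒵}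
    (hN : ∀ (y : g.Site) (v : 𝒴), bN.loc y v ≤ ‖v‖) (hBloc : ∀ (y' : g.Site) (μ : 𝒳), bB.IsLoc y' μ → ‖μ‖ ≤ bB.loc y' μ)
    {δ₀ BG θW cΔ A₀ AH θD c : ℝ}
    (htri : Triangle254 g) (hd : ∀ a b : g.Site, 0 ≤ g.dist a b) (hδ₀ : 0 ≤ δ₀) (hrow : RowSum g (δ₀ / 8) c)
    (hc : 0 ≤ c) (hBG : 0 ≤ BG) (hθW : 0 ≤ θW) (hcΔ : 0 ≤ cΔ) (hA₀ : 0 ≤ A₀) (hAH : 0 ≤ AH) (hθD : 0 ≤ θD)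
    (hG : HasMaj b3 bN (𝒢.restrictScalars ℝ : 𝒵 →ₗ[ℝ] 𝒴) (fun y y' => BG * Real.exp (-(δ₀ * g.dist y y'))))
    (hD2H0 : HasMaj bB b3 ((D2 ∘L H₀).restrictScalars ℝ : 𝒳 →ₗ[ℝ] 𝒵) (fun y y' => cΔ * Real.exp (-(δ₀ * g.dist y y'))))
    (hH0 : HasMaj bB bN (H₀.restrictScalars ℝ : 𝒳 →ₗ[ℝ] 𝒴) (fun y y' => A₀ * Real.exp (-(δ₀ * g.dist y y'))))
    (hH : HasMaj bB bN (H.restrictScalars ℝ : 𝒳 →ₗ[ℝ] 𝒴) (fun y y' => AH * Real.exp (-(δ₀ / 2 * g.dist y y'))))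
    (h189 : ∀ B' : 𝒳, ‖H₀ B'‖ < a → ‖D2 (H₀ B')‖ < j →
      Ineq189 bN b3 ((fderiv ℂ W (solA180 𝒢 W D2 H₀ ε₄ B' + H₀ B')).restrictScalars ℝ : 𝒴 →ₗ[ℝ] 𝒵) θW δ₀)
    (hDfr : ∀ B' : 𝒳, ‖H₀ B'‖ < a → ‖D2 (H₀ B')‖ < j →
      ∃ 𝔇 : 𝒴 →L[ℂ] 𝒳, HasFDerivAt D 𝔇 (solA180 𝒢 W D2 H₀ ε₄ B' + H₀ B') ∧
        HasMaj bN bB (𝔇.restrictScalars ℝ : 𝒴 →ₗ[ℝ] 𝒳) (fun y y' => θD * Real.exp (-(δ₀ / 2 * g.dist y y'))))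
    (hq : qG b3.κ bN.κ BG θW c < 1) :
    ∀ B' : 𝒳, ‖H₀ B'‖ < a → ‖D2 (H₀ B')‖ < j →
      Ineq190 bB bN
        ((fderiv ℂ (chartH179 𝒢 W D2 H₀ (fun Y : 𝒴 => Y - H (D Y)) ε₄) B').restrictScalars ℝ : 𝒳 →ₗ[ℝ] 𝒴)
        (const190 bB.κ bN.κ b3.κ BG θW cΔ A₀ AH θD c) δ₀ := by
  intro B' h𝔄 hJ
  obtain ⟨𝔇, hD𝔇, h𝔇⟩ := hDfr B' h𝔄 hJ
  exact ineq190_sectG R hWa hJ h𝔄 H hD𝔇 hN hBloc htri hd hδ₀ hrow hc hBG hθW hcΔ hA₀ hAH hθD hG (h189 B' h𝔄 hJ)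
    hD2H0 hH0 hH h𝔇 hq

variable {X : Type} {E : Type} [NormedAddCommGroup E] [NormedSpace ℝ E] {box : g.Site → Finset X} {blk : X → g.Site}

/-- **END TO END FOR THE SUP SIZE, FROM LOCATED LEAVES ONLY** — p29 g9's `B11Presentation190.ineq190_and_hmv_supSize_chartH179` with its
hypothesis `h190Y` ((190) on `𝒴` for the actual derivative) DISCHARGED by `ineq190_sectG_dom`: for any lattice presentation
`H B′ x = ev x (𝓗(B′))` of the (179) chart (compatibility letter `x ∈ box y → ‖ev x v‖ ≤ bN.loc y v`) and the canonical derivative family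
`dH t = (x ↦ ev x) ∘ D𝓗(tB)`, the consumers' PAIR `(∀ t ∈ [0,1], Ineq190 bB (supSize g box blk) (dH t) const190 δ₀)` AND the mean-value
domination `hmv` at `y` — the inputs of the B14/B15 (190)-knits (`B15HDecayLeaves.loc_le_of_meanValue`, `B15From190LayerSizes.*`,
`B14From190SupSize.*`). Remaining hypotheses: the scheme's `Regime` and analyticity letters (`hWa`, `hTm`), `Tm 0 = 0` for
`Tm = · − H(D ·)`, the domain condition on `B`, and the located leaves of `ineq190_sectG_dom`.
[cite: Balaban1985Variational, Prop. 9 (190) pp.308–309, (179)–(180) p.306] -/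
theorem ineq190_and_hmv_supSize_sectG (R : Regime 𝒢 0 W B₀ θ C₄ a₃ j a ε₄) (hWa : AnalyticOnNhd ℂ W {Y : 𝒴 | ‖Y‖ < a₃})
    {D : 𝒴 → 𝒳} (H : 𝒳 →L[ℂ] 𝒴) (hTm : AnalyticOnNhd ℂ (fun Y : 𝒴 => Y - H (D Y)) {Y : 𝒴 | ‖Y‖ < ε₄ + a})
    (hTm0 : (0 : 𝒴) - H (D 0) = 0)
    {B : 𝒳} (hB : ‖H₀ B‖ < a ∧ ‖D2 (H₀ B)‖ < j) (ev : X → (𝒴 →L[ℝ] E))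
    {bB : BlockNorm g 𝒳} {bN : BlockNorm g 𝒴} {b3 : BlockNorm g 𝒵}
    (hev : ∀ (y : g.Site) (v : 𝒴), ∀ x ∈ box y, ‖ev x v‖ ≤ bN.loc y v)
    (hN : ∀ (y : g.Site) (v : 𝒴), bN.loc y v ≤ ‖v‖) (hBloc : ∀ (y' : g.Site) (μ : 𝒳), bB.IsLoc y' μ → ‖μ‖ ≤ bB.loc y' μ)
    {δ₀ BG θW cΔ A₀ AH θD c : ℝ}
    (htri : Triangle254 g) (hd : ∀ a b : g.Site, 0 ≤ g.dist a b) (hδ₀ : 0 ≤ δ₀) (hrow : RowSum g (δ₀ / 8) c)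
    (hc : 0 ≤ c) (hBG : 0 ≤ BG) (hθW : 0 ≤ θW) (hcΔ : 0 ≤ cΔ) (hA₀ : 0 ≤ A₀) (hAH : 0 ≤ AH) (hθD : 0 ≤ θD)
    (hG : HasMaj b3 bN (𝒢.restrictScalars ℝ : 𝒵 →ₗ[ℝ] 𝒴) (fun y y' => BG * Real.exp (-(δ₀ * g.dist y y'))))
    (hD2H0 : HasMaj bB b3 ((D2 ∘L H₀).restrictScalars ℝ : 𝒳 →ₗ[ℝ] 𝒵) (fun y y' => cΔ * Real.exp (-(δ₀ * g.dist y y'))))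
    (hH0 : HasMaj bB bN (H₀.restrictScalars ℝ : 𝒳 →ₗ[ℝ] 𝒴) (fun y y' => A₀ * Real.exp (-(δ₀ * g.dist y y'))))
    (hH : HasMaj bB bN (H.restrictScalars ℝ : 𝒳 →ₗ[ℝ] 𝒴) (fun y y' => AH * Real.exp (-(δ₀ / 2 * g.dist y y'))))
    (h189 : ∀ B' : 𝒳, ‖H₀ B'‖ < a → ‖D2 (H₀ B')‖ < j →
      Ineq189 bN b3 ((fderiv ℂ W (solA180 𝒢 W D2 H₀ ε₄ B' + H₀ B')).restrictScalars ℝ : 𝒴 →ₗ[ℝ] 𝒵) θW δ₀)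
    (hDfr : ∀ B' : 𝒳, ‖H₀ B'‖ < a → ‖D2 (H₀ B')‖ < j →
      ∃ 𝔇 : 𝒴 →L[ℂ] 𝒳, HasFDerivAt D 𝔇 (solA180 𝒢 W D2 H₀ ε₄ B' + H₀ B') ∧
        HasMaj bN bB (𝔇.restrictScalars ℝ : 𝒴 →ₗ[ℝ] 𝒳) (fun y y' => θD * Real.exp (-(δ₀ / 2 * g.dist y y'))))
    (hq : qG b3.κ bN.κ BG θW c < 1)
    (Hl : 𝒳 → X → E) (dH : Icc (0:ℝ) 1 → 𝒳 →ₗ[ℝ] (X → E))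
    (hHl : ∀ B' : 𝒳, Hl B' = fun x => ev x (chartH179 𝒢 W D2 H₀ (fun Y : 𝒴 => Y - H (D Y)) ε₄ B'))
    (hdH : ∀ t : Icc (0:ℝ) 1, dH t = (LinearMap.pi fun x => ((ev x : 𝒴 →L[ℝ] E) : 𝒴 →ₗ[ℝ] E)) ∘ₗ
      ((fderiv ℂ (chartH179 𝒢 W D2 H₀ (fun Y : 𝒴 => Y - H (D Y)) ε₄) ((t : ℝ) • B)).restrictScalars ℝ : 𝒳 →ₗ[ℝ] 𝒴))
    (y : g.Site) :
    (∀ t : Icc (0:ℝ) 1, Ineq190 bB (supSize g box blk : BlockNorm g (X → E)) (dH t)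
        (const190 bB.κ bN.κ b3.κ BG θW cΔ A₀ AH θD c) δ₀) ∧
      ∀ s : ℝ, (∀ t, (supSize g box blk : BlockNorm g (X → E)).loc y (dH t B) ≤ s) →
        (supSize g box blk : BlockNorm g (X → E)).loc y (Hl B) ≤ s :=
  ineq190_and_hmv_supSize_chartH179 R hWa hTm hTm0 hB ev hev
    (ineq190_sectG_dom R hWa H hN hBloc htri hd hδ₀ hrow hc hBG hθW hcΔ hA₀ hAH hθD hG hD2H0 hH0 hH h189 hDfr hq)
    Hl dH hHl hdH y

end Actual

end Literature.MathematicalPhysics.QuantumFieldTheory.Balaban1983to89.B11Ineq190Actual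

end
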